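import Literature.NumberTheory.Automorphic.IdeleClassGroupFirstCohomologySolvable
import Literature.Algebra.Homology.CrossedHomSylowTransfer
import Mathlib.GroupTheory.Nilpotent
import HarnessLib

/-!
# `H¹(Gal(E/F), C_E) = 0` for EVERY finite Galois extension of number fields, in cocycle form
# (Tate, Cassels–Fröhlich Ch. VII §9 Thm. 9.1 — axiom I of the global class formation)

Topic `NumberTheory/Automorphic` (ideles, idele classes); namespace
`Literature.NumberTheory.Automorphic.IdeleClassGroup`.  Proof file: theorems only (no definition, no named
fact, no instance; D-0026).  Sequel to `IdeleClassGroupFirstCohomology` (cyclic layers, descent,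
inflation–restriction) and `IdeleClassGroupFirstCohomologySolvable` (solvable layers), closing Tate's proof with
its last step "by the Sylow subgroup argument" (`Algebra/Homology/CrossedHomSylowTransfer`: a crossed
homomorphism whose restriction to a Sylow `p`-subgroup is a coboundary for every `p` is a coboundary).

* **`exists_classGalAct_div_eq`** — for a finite Galois extension of number fields `E/F`, every crossed
  homomorphism `f : Gal(E/F) → C_E = 𝕀_E/Eˣ`, `f (g h) = g • f h · f g` (for the Galois action `classGalAct`),
  is a coboundary `g ↦ g • c / c`; i.e. **`H¹(Gal(E/F), C_E) = 0`** (Tate, Thm. 9.1 (2); Neukirch, *Bonn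
  Lectures* III (3.?) "Axiom I").  For a Sylow `p`-subgroup `P`, `Gal(E/E^P) ≅ P` is a `p`-group, hence
  solvable, so `res_P f` is a coboundary by the solvable case.

What this is NOT: axiom II (`H²(Gal(E/F), C_E)` cyclic of order `[E:F]` with compatible fundamental classes)
is not addressed; nor is the packaging of `C_E` as a `Rep ℤ Gal(E/F)` / `IsClassModule` (Algebra/Homology).

## References

* J. W. S. Cassels, A. Fröhlich (eds.), *Algebraic Number Theory* (1967), Ch. VII (J. Tate) §9 Thm. 9.1
  and its proof ("by the Sylow subgroup argument it suffices …"). [CasselsFrohlichANT1967]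
* J. Neukirch, *Class Field Theory — The Bonn Lectures* (2013), Part III §2–§3. [Neukirch2013]
* J.-P. Serre, *Local Fields*, GTM 67 (1979), Ch. VII §7 Prop. 6, Ch. IX §2 Thm. 4. [SerreLocalFields1979]
-/

noncomputable section

open NumberField
open scoped NumberField

namespace Literature.NumberTheory.Automorphic

namespace IdeleClassGroup

open Literature.NumberTheory.GaloisRepresentations
open Literature.Algebra.Homology

variable {F E : Type} [Field F] [Field E] [Algebra F E] [NumberField F] [NumberField E]

omit [NumberField F] [NumberField E] in
/-- `restrictScalars F : Gal(E/M) → Gal(E/F)` is multiplicative. [folklore] -/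
private theorem restrictScalars_mul' {M : Type} [Field M] [Algebra F M] [Algebra M E] [IsScalarTower F M E]
    (τ₁ τ₂ : E ≃ₐ[M] E) : (τ₁ * τ₂).restrictScalars F = τ₁.restrictScalars F * τ₂.restrictScalars F :=
  AlgEquiv.ext fun _ => rfl

/-- **Restriction to the fixed field of a subgroup**: for `H ≤ Gal(E/F)` and `M = E^H`, if every crossed
homomorphism `Gal(E/M) → C_E` is a coboundary then the restriction to `H` of every crossed homomorphism
`f : Gal(E/F) → C_E` is a coboundary on `H` (`Gal(E/M) ≅ H`, `IntermediateField.subgroupEquivAlgEquiv`, acting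
on `C_E` through `Gal(E/F)`, `classGalAct_restrictScalars`). [cite: CasselsFrohlichANT1967, Ch. VII §9 Thm. 9.1 (proof)] -/
theorem exists_forall_mem_classGalAct_div_eq_of_fixedField [IsGalois F E] (H : Subgroup (E ≃ₐ[F] E))
    (hM : ∀ f : (E ≃ₐ[IntermediateField.fixedField H] E) → IdeleClassGroup E,
      (∀ g h, f (g * h) = classGalAct g (f h) * f g) →
      ∃ c : IdeleClassGroup E, ∀ g, classGalAct g c / c = f g)
    (f : (E ≃ₐ[F] E) → IdeleClassGroup E) (hf : ∀ g h, f (g * h) = classGalAct g (f h) * f g) :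
    ∃ c : IdeleClassGroup E, ∀ h ∈ H, classGalAct h c / c = f h := by
  obtain ⟨c, hc⟩ := hM (fun τ => f (τ.restrictScalars F)) fun τ₁ τ₂ => by
    simp only [restrictScalars_mul', hf, classGalAct_restrictScalars]
  refine ⟨c, fun h hh => ?_⟩
  set τ : E ≃ₐ[IntermediateField.fixedField H] E := IntermediateField.subgroupEquivAlgEquiv H ⟨h, hh⟩ with hτ
  have hτh : τ.restrictScalars F = h := AlgEquiv.ext fun _ => rfl
  rw [← hτh, classGalAct_restrictScalars]
  exact hc τ

/-- **`H¹(Gal(E/F), C_E) = 0` for every finite Galois extension of number fields, cocycle form** (Tate,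
Cassels–Fröhlich Ch. VII §9 Thm. 9.1 (2): "`H¹(G, C_L) = 0`" — axiom I of the class formation
`(Gal(E/F), C_E)`): every crossed homomorphism `f : Gal(E/F) → C_E`, `f (g h) = g • f h · f g`, is a coboundary,
`f g = g • c / c` for one idele class `c`.  Proof as printed: for every prime `p` and Sylow `p`-subgroup `P`,
`Gal(E/E^P) ≅ P` is a `p`-group, hence solvable, so `res_P f` is a coboundary
(`exists_classGalAct_div_eq_of_isSolvable`, `exists_forall_mem_classGalAct_div_eq_of_fixedField`); the Sylow
criterion `CrossedHomElem.exists_coboundary_of_sylow` (`cor ∘ res = [G : P]`, prime to `p`) concludes.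
[cite: CasselsFrohlichANT1967, Ch. VII §9 Thm. 9.1 (2)] -/
theorem exists_classGalAct_div_eq [IsGalois F E] (f : (E ≃ₐ[F] E) → IdeleClassGroup E)
    (hf : ∀ g h, f (g * h) = classGalAct g (f h) * f g) :
    ∃ c : IdeleClassGroup E, ∀ g, classGalAct g c / c = f g := by
  classical
  refine CrossedHomElem.exists_coboundary_of_sylow (f := f)
    (fun g : E ≃ₐ[F] E => (classGalAct g : IdeleClassGroup E →ₜ* IdeleClassGroup E).toMonoidHom)
    classGalAct_toMonoidHom_mul classGalAct_toMonoidHom_one hf fun p _ P => ?_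
  -- `Gal(E/E^P) ≅ P` is a `p`-group, hence solvable
  haveI : IsGalois (IntermediateField.fixedField (P : Subgroup (E ≃ₐ[F] E))) E :=
    IsGalois.tower_top_of_isGalois F (IntermediateField.fixedField (P : Subgroup (E ≃ₐ[F] E))) E
  haveI : Group.IsNilpotent (P : Subgroup (E ≃ₐ[F] E)) := P.isPGroup'.isNilpotent
  haveI : IsSolvable (E ≃ₐ[IntermediateField.fixedField (P : Subgroup (E ≃ₐ[F] E))] E) :=
    solvable_of_surjective
      (f := (IntermediateField.subgroupEquivAlgEquiv (P : Subgroup (E ≃ₐ[F] E))).toMonoidHom)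
      (IntermediateField.subgroupEquivAlgEquiv (P : Subgroup (E ≃ₐ[F] E))).surjective
  exact exists_forall_mem_classGalAct_div_eq_of_fixedField (P : Subgroup (E ≃ₐ[F] E))
    (fun f' hf' => exists_classGalAct_div_eq_of_isSolvable f' hf') f hf

/-- **Axiom I on every subgroup, element form**: for `E/F` a finite Galois extension of number fields and
ANY subgroup `H ≤ Gal(E/F)`, every crossed homomorphism `u : H → C_E` (`u (a b) = a • u b · u a`, `H` acting
through `Gal(E/F)`) is a coboundary `a ↦ a • c / c` — the shape `∀ U ≤ G, H¹(U, C_E) = 0` of the class-module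
axiom (Lang / Neukirch I §7; the tree's `Algebra.Homology.IsClassModule.isZero_H1`), obtained from
`exists_classGalAct_div_eq` for the layer `E / E^H` transported along `H ≃* Gal(E/E^H)`
(`IntermediateField.subgroupEquivAlgEquiv`). [cite: CasselsFrohlichANT1967, Ch. VII §9 Thm. 9.1 (2)] -/
theorem exists_classGalAct_div_eq_subgroup [IsGalois F E] (H : Subgroup (E ≃ₐ[F] E))
    (u : H → IdeleClassGroup E)
    (hu : ∀ a b : H, u (a * b) = classGalAct (a : E ≃ₐ[F] E) (u b) * u a) :
    ∃ c : IdeleClassGroup E, ∀ a : H, classGalAct (a : E ≃ₐ[F] E) c / c = u a := by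
  haveI : IsGalois (IntermediateField.fixedField H) E :=
    IsGalois.tower_top_of_isGalois F (IntermediateField.fixedField H) E
  set e := IntermediateField.subgroupEquivAlgEquiv H with he
  have hres : ∀ τ : E ≃ₐ[IntermediateField.fixedField H] E,
      ((e.symm τ : H) : E ≃ₐ[F] E) = τ.restrictScalars F := fun τ => by
    conv_rhs => rw [← e.apply_symm_apply τ]
    exact AlgEquiv.ext fun _ => rfl
  obtain ⟨c, hc⟩ := exists_classGalAct_div_eq (F := IntermediateField.fixedField H) (E := E)
    (fun τ => u (e.symm τ)) fun τ₁ τ₂ => by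
      simp only [map_mul, hu, hres, classGalAct_restrictScalars]
  refine ⟨c, fun a => ?_⟩
  have ha : (a : E ≃ₐ[F] E) = (e a).restrictScalars F := by
    rw [← hres, e.symm_apply_apply]
  rw [ha, classGalAct_restrictScalars, hc, e.symm_apply_apply]

end IdeleClassGroup

end Literature.NumberTheory.Automorphic

end
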